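import Summits.Ventures.YMGap.SlabDobrushinDoor
import Literature.MathematicalPhysics.QuantumFieldTheory.DurhuusFrohlichSlabCriterion
import Summits.QuantumFields.BalabanUV.InfraRed.StrongCouplingQuarterModulusTwoSevenths
import HarnessLib

/-!
# Venture YMGap, track (a) / A4, part 3 — from the slab door to Wilson's AREA LAW via the Durhuus–Fröhlich criterion
# (named fact `durhuusFrohlich_areaLaw_of_slabClustering`, CNS25 Thm. 2.3); `SU(2)`, `d = 4`: area law for all `0 ≤ β_W < 2/7`

HONEST FRAMING: venture file of the cell `pub-ymgap` (QuantumFields programme). With its sibling `SlabSpecification` it formalises the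
finite-volume slab σ-model used by Durhuus–Fröhlich (CMP 75 (1980)) and by Cao–Nissim–Sheffield (arXiv:2509.04688, Def. 2.1,
Thm. 2.3) to derive the Wilson AREA LAW at strong coupling, and proves the «Dobrushin door» for it: a one-link
Kantorovich–Rubinstein modulus (the tree's named hypothesis `OneLinkKRModulus N R K`, decided off-kernel for
`SU(2)`) with `2(d-1)|β| K < 1` gives covariance decay of single-site bounded Lipschitz observables, UNIFORM in
the boundary fields and the volume.  Strong-coupling LATTICE statement only; no continuum limit, no mass-gap or
Clay claim; the area-law conclusion is drawn HERE modulo the printed Durhuus–Fröhlich/CNS criterion, taken as the tree's named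
Literature fact `durhuusFrohlich_areaLaw_of_slabClustering d N` (an explicit hypothesis of every area-law theorem below).  Specification of the task: `HOME/p2/SLAB-DOOR.md`.

Model (CNS25 Def. 2.1, 't Hooft scaling): slice `Λ = (ℤ/L)^n` (`n = d-1`), spins `Q_x ∈ SU(N)`, positively
oriented edges `e = (x, i)` from `x` to `x + e_i`, boundary fields `A_e, B_e ∈ U(N)`,
`S_{A,B}(Q) = N β ∑_e Re tr(Q_x A_e Q_{x+e_i}⁻¹ B_e⁻¹)`, `μ_{A,B} ∝ exp(S_{A,B}) ∏ dQ_x`.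
-/

noncomputable section

open MeasureTheory Filter Topology Function ProbabilityTheory
open scoped NNReal Matrix
open Literature.Probability.LatticeModels Literature.Probability.LatticeModels.DobrushinMetric
open Literature.MathematicalPhysics.QuantumLattice
open Literature.MathematicalPhysics.QuantumFieldTheory
open Literature.MathematicalPhysics.QuantumFieldTheory.Balaban1983to89.StrongCouplingDobrushinWindow

namespace Summit.Ventures.YMGap.Slab

variable {n L N : ℕ} [NeZero L]

/-! ## Part 3 — from the door to Wilson's AREA LAW via the Durhuus–Fröhlich criterion (named fact) -/

section AreaLaw


omit [NeZero L] in
/-- The venture's edge endpoint is the Literature file's `Site.shift`: `x + e_i`. [folklore] -/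
theorem SlabEdge.tgt_eq_shift (e : SlabEdge n L) : e.tgt = Literature.MathematicalPhysics.QuantumFieldTheory.Site.shift e.1 e.2 := by
  funext j
  simp only [SlabEdge.tgt, Literature.MathematicalPhysics.QuantumFieldTheory.Site.shift, Function.update_apply, Pi.add_apply, Pi.single_apply]
  split_ifs with h
  · subst h; rfl
  · rw [add_zero]

/-- The venture's slab energy IS the Literature file's slab action (CNS Def. 2.1) — inverses of (special) unitary matrices are
conjugate transposes. [cite: CaoNissimSheffield2025dynamical, Definition 2.1] -/
theorem slabEnergy_eq_slabAction (β : ℝ) (A B : SlabEdge n L → Matrix.unitaryGroup (Fin N) ℂ) :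
    slabEnergy (n := n) (L := L) N β A B = slabAction N β A B := by
  funext Q
  unfold slabEnergy slabAction
  congr 1
  refine Finset.sum_congr rfl fun e _ => ?_
  rw [SlabEdge.tgt_eq_shift]
  rfl

/-- Gluing on the full volume pushes the product Haar measure on `SU(N)^{univ}` to the product Haar measure on `SU(N)^{sites}`.
[folklore] -/
theorem map_glueWith_univ_pi_site (η : SlabConfig n L N) :
    (Measure.pi fun _ : ↥(Finset.univ : Finset (TorusSite n L)) => haarProbability (SU N)).map
        (glueWith Finset.univ · η) =
      Measure.pi fun _ : TorusSite n L => haarProbability (SU N) := by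
  let f : ↥(Finset.univ : Finset (TorusSite n L)) ≃ TorusSite n L :=
    ⟨fun x => x.1, fun e => ⟨e, Finset.mem_univ e⟩, fun x => by simp, fun e => rfl⟩
  have hglue : (fun ζ : ↥(Finset.univ : Finset (TorusSite n L)) → SU N => glueWith Finset.univ ζ η) =
      MeasurableEquiv.piCongrLeft (fun _ : TorusSite n L => SU N) f := by
    funext ζ e
    rw [glueWith_apply_mem _ _ _ (Finset.mem_univ e), MeasurableEquiv.coe_piCongrLeft,
      Equiv.piCongrLeft_apply_eq_cast]
    rfl
  rw [hglue]
  exact (measurePreserving_piCongrLeft (fun _ : TorusSite n L => haarProbability (SU N)) f).map_eq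

/-- **The venture's slab measure IS the Literature file's `slabMeasure`** (product Haar tilted by the slab action).
[cite: CaoNissimSheffield2025dynamical, Definition 2.1] -/
theorem slabMeasure_eq (β : ℝ) (A B : SlabEdge n L → Matrix.unitaryGroup (Fin N) ℂ) :
    slabMeasure (n := n) (L := L) β A B = Literature.MathematicalPhysics.QuantumFieldTheory.slabMeasure N β A B := by
  rw [slabMeasure, slabSpec, map_glueWith_univ_pi_site, slabEnergy_eq_slabAction]
  rfl

/-! ### The torus graph distance is an admissible Dobrushin profile -/

omit [NeZero L] in
/-- `|a + 1|_{ℤ/L} ≤ |a|_{ℤ/L} + 1` for the cyclic absolute value `|·| = |valMinAbs ·|`. [folklore] -/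
theorem natAbs_valMinAbs_add_one_le [NeZero L] (a : ZMod L) :
    ((a + 1).valMinAbs).natAbs ≤ (a.valMinAbs).natAbs + 1 := by
  have he : (((a + 1).valMinAbs : ℤ) : ZMod L) = ((a.valMinAbs + 1 : ℤ) : ZMod L) := by
    push_cast [ZMod.coe_valMinAbs]; rfl
  have h1 : ((a + 1).valMinAbs).natAbs ≤ (a.valMinAbs + 1).natAbs :=
    ZMod.natAbs_min_of_le_div_two L _ _ he (ZMod.natAbs_valMinAbs_le _)
  calc ((a + 1).valMinAbs).natAbs ≤ (a.valMinAbs + 1).natAbs := h1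
    _ ≤ (a.valMinAbs).natAbs + (1 : ℤ).natAbs := Int.natAbs_add_le _ _
    _ = (a.valMinAbs).natAbs + 1 := by simp

omit [NeZero L] in
/-- `|a|_{ℤ/L} ≤ |a + 1|_{ℤ/L} + 1`. [folklore] -/
theorem natAbs_valMinAbs_le_add_one [NeZero L] (a : ZMod L) :
    (a.valMinAbs).natAbs ≤ ((a + 1).valMinAbs).natAbs + 1 := by
  have h := natAbs_valMinAbs_add_one_le (L := L) (-(a + 1))
  rw [ZMod.natAbs_valMinAbs_neg] at h
  have : -(a + 1) + 1 = -a := by ring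
  rw [this, ZMod.natAbs_valMinAbs_neg] at h
  exact h

/-- One lattice step changes the torus graph distance by at most one: `d(x, y) ≤ d(x + e_i, y) + 1` and
`d(x + e_i, y) ≤ d(x, y) + 1`. [cite: FriedliVelenik2017, §3.1] -/
theorem torusGraphDist_shift_le (x y : Site n L) (i : Fin n) :
    torusGraphDist x y ≤ torusGraphDist (Literature.MathematicalPhysics.QuantumFieldTheory.Site.shift x i) y + 1 ∧
      torusGraphDist (Literature.MathematicalPhysics.QuantumFieldTheory.Site.shift x i) y ≤ torusGraphDist x y + 1 := by
  classical
  unfold torusGraphDist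
  have hsplit : ∀ z : Site n L, ∑ j, ((z j - y j).valMinAbs).natAbs =
      ((z i - y i).valMinAbs).natAbs + ∑ j ∈ Finset.univ.erase i, ((z j - y j).valMinAbs).natAbs :=
    fun z => (Finset.add_sum_erase _ _ (Finset.mem_univ i)).symm
  have hrest : ∑ j ∈ Finset.univ.erase i, (((Literature.MathematicalPhysics.QuantumFieldTheory.Site.shift x i) j - y j).valMinAbs).natAbs =
      ∑ j ∈ Finset.univ.erase i, ((x j - y j).valMinAbs).natAbs := by
    refine Finset.sum_congr rfl fun j hj => ?_
    have hji : j ≠ i := Finset.ne_of_mem_erase hj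
    simp [Literature.MathematicalPhysics.QuantumFieldTheory.Site.shift, hji]
  have hi : (Literature.MathematicalPhysics.QuantumFieldTheory.Site.shift x i) i - y i = (x i - y i) + 1 := by
    simp only [Literature.MathematicalPhysics.QuantumFieldTheory.Site.shift, Pi.add_apply, Pi.single_eq_same]; ring
  rw [hsplit x, hsplit (Literature.MathematicalPhysics.QuantumFieldTheory.Site.shift x i), hrest, hi]
  constructor
  · have := natAbs_valMinAbs_le_add_one (L := L) (x i - y i); omega
  · have := natAbs_valMinAbs_add_one_le (L := L) (x i - y i); omega

/-- The torus graph distance to a fixed site is an admissible Dobrushin profile for the slab neighbourhoods: it is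
1-Lipschitz along slab edges. [cite: FriedliVelenik2017, §3.1] -/
theorem torusGraphDist_profile (y : TorusSite n L) :
    ∀ z : TorusSite n L, z ≠ y → ∀ w ∈ slabNbr z, torusGraphDist z y ≤ torusGraphDist w y + 1 := by
  classical
  intro z _ w hw
  simp only [slabNbr, Finset.mem_union, Finset.mem_image, outEdges, inEdges, Finset.mem_filter, Finset.mem_univ,
    true_and] at hw
  rcases hw with ⟨e, he, rfl⟩ | ⟨e, he, rfl⟩
  · rw [SlabEdge.tgt_eq_shift, ← he]
    exact (torusGraphDist_shift_le e.1 y e.2).1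
  · have hz : z = Literature.MathematicalPhysics.QuantumFieldTheory.Site.shift e.1 e.2 := by rw [← SlabEdge.tgt_eq_shift, he]
    rw [hz]
    exact (torusGraphDist_shift_le e.1 y e.2).2

/-! ### The matrix-entry observables of the criterion -/

/-- A real part / imaginary part map is measurable and 1-Lipschitz on `ℂ`. [folklore] -/
theorem reIm_lipschitz {φ : ℂ → ℝ} (hφ : φ = Complex.re ∨ φ = Complex.im) :
    Measurable φ ∧ ∀ z w : ℂ, |φ z - φ w| ≤ ‖z - w‖ := by
  rcases hφ with rfl | rfl
  · exact ⟨Complex.measurable_re, fun z w => by rw [← Complex.sub_re]; exact Complex.abs_re_le_norm _⟩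
  · exact ⟨Complex.measurable_im, fun z w => by rw [← Complex.sub_im]; exact Complex.abs_im_le_norm _⟩

omit [NeZero L] in
/-- The entry observable `Q ↦ φ((Q_x)_{ij})` (`φ ∈ {Re, Im}`) is measurable, single-site, bounded by `1` and 1-Lipschitz for the
Frobenius distance at `x`. [folklore] -/
theorem entryObs_props (x : TorusSite n L) (i j : Fin N) {φ : ℂ → ℝ} (hφ : φ = Complex.re ∨ φ = Complex.im) :
    Measurable (fun Q : SlabConfig n L N => φ ((Q x : Matrix (Fin N) (Fin N) ℂ) i j)) ∧
      DependsOn (fun Q : SlabConfig n L N => φ ((Q x : Matrix (Fin N) (Fin N) ℂ) i j)) ({x} : Set (TorusSite n L)) ∧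
      (∀ Q : SlabConfig n L N, |φ ((Q x : Matrix (Fin N) (Fin N) ℂ) i j)| ≤ 1) ∧
      IsLipBound suFrobDist (fun Q : SlabConfig n L N => φ ((Q x : Matrix (Fin N) (Fin N) ℂ) i j))
        fun z => if z = x then 1 else 0 := by
  obtain ⟨hφm, hφL⟩ := reIm_lipschitz hφ
  refine ⟨?_, ?_, ?_, ?_⟩
  · exact hφm.comp ((continuous_subtype_val.matrix_elem i j).measurable.comp (measurable_pi_apply x))
  · intro Q Q' h; simp only at h ⊢; rw [h x rfl]
  · intro Q
    have h0 := hφL ((Q x : Matrix (Fin N) (Fin N) ℂ) i j) 0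
    have hφ0 : φ 0 = 0 := by rcases hφ with rfl | rfl <;> simp
    rw [hφ0, sub_zero, sub_zero] at h0
    exact h0.trans (entry_norm_bound_of_unitary (su_mem_unitaryGroup (Q x)) i j)
  · refine ⟨fun z => by positivity, fun z σ τ hστ => ?_⟩
    by_cases hz : z = x
    · subst hz
      rw [if_pos rfl, one_mul]
      refine (hφL _ _).trans ?_
      rw [← Matrix.sub_apply]
      exact norm_entry_le_frobNorm _ i j
    · rw [hστ x (Ne.symm hz), sub_self, abs_zero, if_neg hz, zero_mul]

omit [NeZero L] in
/-- The inverse-entry observable `Q ↦ ψ((Q_y⁻¹)_{kl})` (`ψ ∈ {Re, Im}`) is measurable, single-site, bounded by `1` and 1-Lipschitz for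
the Frobenius distance at `y` (`Q⁻¹ = Qᴴ` on `SU(N)`). [folklore] -/
theorem invEntryObs_props (y : TorusSite n L) (k l : Fin N) {ψ : ℂ → ℝ} (hψ : ψ = Complex.re ∨ ψ = Complex.im) :
    Measurable (fun Q : SlabConfig n L N => ψ ((((Q y)⁻¹ : SU N) : Matrix (Fin N) (Fin N) ℂ) k l)) ∧
      DependsOn (fun Q : SlabConfig n L N => ψ ((((Q y)⁻¹ : SU N) : Matrix (Fin N) (Fin N) ℂ) k l))
        ({y} : Set (TorusSite n L)) ∧
      (∀ Q : SlabConfig n L N, |ψ ((((Q y)⁻¹ : SU N) : Matrix (Fin N) (Fin N) ℂ) k l)| ≤ 1) ∧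
      IsLipBound suFrobDist (fun Q : SlabConfig n L N => ψ ((((Q y)⁻¹ : SU N) : Matrix (Fin N) (Fin N) ℂ) k l))
        fun z => if z = y then 1 else 0 := by
  obtain ⟨hψm, hψL⟩ := reIm_lipschitz hψ
  have hinv : ∀ Q : SlabConfig n L N, (((Q y)⁻¹ : SU N) : Matrix (Fin N) (Fin N) ℂ) k l =
      star ((Q y : Matrix (Fin N) (Fin N) ℂ) l k) := fun Q => by
    rw [su_coe_inv, Matrix.conjTranspose_apply]
  simp_rw [hinv]
  refine ⟨?_, ?_, ?_, ?_⟩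
  · exact hψm.comp (continuous_star.measurable.comp
      ((continuous_subtype_val.matrix_elem l k).measurable.comp (measurable_pi_apply y)))
  · intro Q Q' h; simp only at h ⊢; rw [h y rfl]
  · intro Q
    have h0 := hψL (star ((Q y : Matrix (Fin N) (Fin N) ℂ) l k)) 0
    have hψ0 : ψ 0 = 0 := by rcases hψ with rfl | rfl <;> simp
    rw [hψ0, sub_zero, sub_zero, norm_star] at h0
    exact h0.trans (entry_norm_bound_of_unitary (su_mem_unitaryGroup (Q y)) l k)
  · refine ⟨fun z => by positivity, fun z σ τ hστ => ?_⟩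
    by_cases hz : z = y
    · subst hz
      rw [if_pos rfl, one_mul]
      refine (hψL _ _).trans ?_
      rw [← star_sub, norm_star, ← Matrix.sub_apply]
      exact norm_entry_le_frobNorm _ l k
    · rw [hστ y (Ne.symm hz), sub_self, abs_zero, if_neg hz, zero_mul]

/-- A crude covariance bound for bounded observables under a probability measure: `|cov(f,g)| ≤ 2a · 2b`. [folklore] -/
theorem abs_cov_le_of_abs_le {Ω : Type*} [MeasurableSpace Ω] {μ : Measure Ω} [IsProbabilityMeasure μ] {f g : Ω → ℝ}
    {a b : ℝ} (hf : ∀ ω, |f ω| ≤ a) (hg : ∀ ω, |g ω| ≤ b) : |cov[f, g; μ]| ≤ 2 * a * (2 * b) := by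
  have ha : 0 ≤ a := (abs_nonneg _).trans (hf (Classical.choice (nonempty_of_isProbabilityMeasure μ)))
  have hmf : |∫ ω, f ω ∂μ| ≤ a := by
    have := norm_integral_le_of_norm_le_const (μ := μ) (f := f) (C := a) (ae_of_all _ fun ω => by
      rw [Real.norm_eq_abs]; exact hf ω)
    simpa [Real.norm_eq_abs] using this
  have hmg : |∫ ω, g ω ∂μ| ≤ b := by
    have := norm_integral_le_of_norm_le_const (μ := μ) (f := g) (C := b) (ae_of_all _ fun ω => by
      rw [Real.norm_eq_abs]; exact hg ω)
    simpa [Real.norm_eq_abs] using this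
  have hpt : ∀ ω, |(f ω - ∫ x, f x ∂μ) * (g ω - ∫ x, g x ∂μ)| ≤ 2 * a * (2 * b) := fun ω => by
    rw [abs_mul]
    refine mul_le_mul ?_ ?_ (abs_nonneg _) (by linarith)
    · calc |f ω - ∫ x, f x ∂μ| ≤ |f ω| + |∫ x, f x ∂μ| := abs_sub _ _
        _ ≤ a + a := add_le_add (hf ω) hmf
        _ = 2 * a := by ring
    · calc |g ω - ∫ x, g x ∂μ| ≤ |g ω| + |∫ x, g x ∂μ| := abs_sub _ _
        _ ≤ b + b := add_le_add (hg ω) hmg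
        _ = 2 * b := by ring
  have := norm_integral_le_of_norm_le_const (μ := μ)
    (f := fun ω => (f ω - ∫ x, f x ∂μ) * (g ω - ∫ x, g x ∂μ)) (C := 2 * a * (2 * b))
    (ae_of_all _ fun ω => by rw [Real.norm_eq_abs]; exact hpt ω)
  simpa [covariance, Real.norm_eq_abs] using this

/-! ### Boundary-uniform slab clustering from a one-link modulus, and the area law -/

/-- **Boundary-uniform slab clustering from a one-link Kantorovich–Rubinstein modulus** — the HYPOTHESIS of the
Durhuus–Fröhlich/CNS criterion `durhuusFrohlich_areaLaw_of_slabClustering`, for `SU(N)` at 't Hooft coupling `β ≥ 0`: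
if `OneLinkKRModulus N R K` with `R ≥ 2nβ` and `c = 2nβK < 1`, then with `C₁ = 8N`, `C₂ = −log max(c, 1/2) > 0`, for ALL slab
sizes `L`, boundary fields `A, B`, sites and indices, `|Cov_{μ_{A,B}}(φ(Q_x)_{ij}, ψ(Q_y⁻¹)_{kl})| ≤ C₁ e^{−C₂ d(x,y)}`.
[cite: CaoNissimSheffield2025dynamical, Theorem 2.3] [cite: Follmer1988, Ch. I Theorem (2.13)] -/
theorem slabClustering_of_oneLinkKRModulus (hN : 1 ≤ N) {β R K : ℝ} (hβ : 0 ≤ β) (hK : 0 ≤ K)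
    (hR : β * (2 * (n : ℝ)) ≤ R) (hmod : OneLinkKRModulus N R K) (hc : 2 * (n : ℝ) * β * K < 1) :
    ∃ C₁ C₂ : ℝ, 0 < C₂ ∧
      ∀ (L : ℕ) [NeZero L] (A B : Edge n L → Matrix.unitaryGroup (Fin N) ℂ)
        (x y : Site n L) (i j k l : Fin N) (φ ψ : ℂ → ℝ),
        (φ = Complex.re ∨ φ = Complex.im) → (ψ = Complex.re ∨ ψ = Complex.im) →
          |cov[fun Q => φ ((Q x : Matrix (Fin N) (Fin N) ℂ) i j),
              fun Q => ψ ((((Q y)⁻¹ : Matrix.specialUnitaryGroup (Fin N) ℂ) :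
                Matrix (Fin N) (Fin N) ℂ) k l);
              Literature.MathematicalPhysics.QuantumFieldTheory.slabMeasure N β A B]| ≤
            C₁ * Real.exp (-C₂ * torusGraphDist x y) := by
  classical
  set c : ℝ := 2 * (n : ℝ) * β * K with hcdef
  have hc0 : 0 ≤ c := by positivity
  set c' : ℝ := max c (1 / 2) with hc'
  have hc'0 : 0 < c' := lt_max_of_lt_right (by norm_num)
  have hc'1 : c' < 1 := max_lt hc (by norm_num)
  refine ⟨8 * N, -Real.log c', neg_pos.2 (Real.log_neg hc'0 hc'1), ?_⟩
  intro L _ A B x y i j k l φ ψ hφ hψ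
  obtain ⟨hfm, hfdep, hf1, hfL⟩ := entryObs_props (n := n) (L := L) x i j hφ
  obtain ⟨hgm, hgdep, hg1, hgL⟩ := invEntryObs_props (n := n) (L := L) y k l hψ
  have hN8 : (2 : ℝ) * (2 * Real.sqrt N) ^ 2 = 8 * N := by
    rw [mul_pow, Real.sq_sqrt (Nat.cast_nonneg N)]; ring
  -- the exponential form of the profile bound: c^d ≤ c'^d = exp(-(-log c') d)
  have hexp : c ^ torusGraphDist x y ≤ Real.exp (-(-Real.log c') * (torusGraphDist x y : ℝ)) := by
    rw [neg_neg, mul_comm, Real.exp_nat_mul, Real.exp_log hc'0]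
    exact pow_le_pow_left₀ hc0 (le_max_left _ _) _
  by_cases hL : L = 1
  · -- degenerate slice: one site, crude bound `|cov| ≤ 4 ≤ 8N`
    subst hL
    haveI := isProbabilityMeasure_slabMeasure (n := n) (L := 1) N β A B
    have hxy : x = y := Subsingleton.elim _ _
    subst hxy
    have h4 := abs_cov_le_of_abs_le (μ := Literature.MathematicalPhysics.QuantumFieldTheory.slabMeasure N β A B) hf1 hg1
    rw [torusGraphDist_self, Nat.cast_zero, mul_zero, Real.exp_zero, mul_one]
    have hN2 : (4 : ℝ) ≤ 8 * N := by
      have : (1 : ℝ) ≤ N := by exact_mod_cast hN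
      linarith
    linarith
  · have hL' : ∀ e : SlabEdge n L, e.tgt ≠ e.1 := SlabEdge.tgt_ne_fst hL
    have habs : |β| = β := abs_of_nonneg hβ
    have key := slab_covariance_le (n := n) (L := L) hN hL' hK (by rwa [habs]) hmod
      (by rw [habs]; exact hc.le) A B x y hfm hfdep hf1 hfL hgm hgdep hg1 hgL
      (fun z => torusGraphDist z y) (torusGraphDist_self y) (torusGraphDist_profile y)
    rw [slabMeasure_eq, habs] at key
    calc |cov[fun Q => φ ((Q x : Matrix (Fin N) (Fin N) ℂ) i j),
            fun Q => ψ ((((Q y)⁻¹ : Matrix.specialUnitaryGroup (Fin N) ℂ) : Matrix (Fin N) (Fin N) ℂ) k l);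
            Literature.MathematicalPhysics.QuantumFieldTheory.slabMeasure N β A B]|
        ≤ 2 * (2 * Real.sqrt N) ^ 2 * 1 * ((2 * (n : ℝ) * β * K) ^ torusGraphDist x y * 1) := key
      _ = 8 * N * c ^ torusGraphDist x y := by rw [← hN8, hcdef]; ring
      _ ≤ 8 * N * Real.exp (-(-Real.log c') * torusGraphDist x y) :=
          mul_le_mul_of_nonneg_left hexp (by positivity)

/-- **AREA LAW FROM A ONE-LINK MODULUS (track (a) / A4 headline shape).**  Under the Durhuus–Fröhlich criterion as restated and used
by Cao–Nissim–Sheffield (the tree's named fact `durhuusFrohlich_areaLaw_of_slabClustering d N`, CNS Thm. 2.3), a one-link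
Kantorovich–Rubinstein modulus `OneLinkKRModulus N R K` on the ball `R ≥ 2(d−1)β` with `2(d−1)βK < 1` gives Wilson's AREA LAW
`HasAreaLaw d (fundamentalRep (Fin N)) (Nβ)` for `SU(N)` lattice Yang–Mills at 't Hooft coupling `β ≥ 0` (tree coupling `Nβ`).
The slab Dobrushin constant `2(d−1)βK` is one THIRD of the full model's `6(d−1)βK` (each slab site has `2(d−1)` neighbours).
Strong-coupling lattice statement; no continuum or mass-gap claim. [cite: CaoNissimSheffield2025dynamical, Theorem 2.3] -/
theorem hasAreaLaw_of_oneLinkKRModulus {d : ℕ} (h : durhuusFrohlich_areaLaw_of_slabClustering d N) (hd : 2 ≤ d)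
    (hN : 2 ≤ N) {β R K : ℝ} (hβ : 0 ≤ β) (hK : 0 ≤ K) (hR : β * (2 * ((d : ℝ) - 1)) ≤ R)
    (hmod : OneLinkKRModulus N R K) (hc : 2 * ((d : ℝ) - 1) * β * K < 1) :
    HasAreaLaw d (fundamentalRep (Fin N)) ((N : ℝ) * β) := by
  have hcast : (((d - 1 : ℕ) : ℝ)) = (d : ℝ) - 1 := by
    rw [Nat.cast_sub (by omega : 1 ≤ d)]; simp
  refine h.hasAreaLaw hd hN hβ ?_
  have := slabClustering_of_oneLinkKRModulus (n := d - 1) (N := N) (by omega) hβ hK (by rwa [hcast]) hmod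
    (by rwa [hcast])
  exact this

/-- **`SU(2)`, `d = 4`, Wilson units.**  With the tree's schema `OneLinkKRModulusSU2 βW K₂ = OneLinkKRModulus 2 (3βW/2) (4K₂)`
('t Hooft `β = βW/4`, tree coupling `2β = βW/2`): the criterion plus a modulus with `6 βW K₂ < 1` give the area law
`HasAreaLaw 4 (fundamentalRep (Fin 2)) (βW/2)`.  With the in-tree quarter modulus `K₂ = 1/4` (valid for `0 ≤ βW < 2/7`,
`quarterModulusUpTo_twoSevenths`) the condition reads `3βW/2 < 1`, automatically true there: AREA LAW FOR ALL `0 ≤ βW < 2/7`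
modulo the named fact — against the printed `βW < 1/6` (CNS Thm. 1.6). [cite: CaoNissimSheffield2025dynamical, Theorems 1.6 and 2.3] -/
theorem su2_hasAreaLaw_of_oneLinkKRModulusSU2 (h : durhuusFrohlich_areaLaw_of_slabClustering 4 2) {βW K₂ : ℝ}
    (hβ : 0 ≤ βW) (hK : 0 ≤ K₂) (hmod : OneLinkKRModulusSU2 βW K₂) (hc : 6 * βW * K₂ < 1) :
    HasAreaLaw 4 (fundamentalRep (Fin 2)) (βW / 2) := by
  have h2 : ((2 : ℕ) : ℝ) * (βW / 4) = βW / 2 := by push_cast; ring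
  rw [← h2]
  refine hasAreaLaw_of_oneLinkKRModulus h (by norm_num) le_rfl (β := βW / 4) (R := 3 * βW / 2) (K := 4 * K₂)
    (by positivity) (by positivity) (by push_cast; linarith) hmod (by push_cast; nlinarith)

/-- **`SU(2)` area law for `0 ≤ βW < 2/7` from the quarter modulus** (hypothesis `hq`: the in-tree certificate
`OneLinkKRModulusSU2 βW (1/4)`, available as `quarterModulusUpTo_twoSevenths βW hβ hlt` in
`Summits.QuantumFields.BalabanUV.InfraRed.StrongCouplingQuarterModulusTwoSevenths`), modulo the Durhuus–Fröhlich/CNS named fact.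
[cite: CaoNissimSheffield2025dynamical, Theorem 2.3] -/
theorem su2_hasAreaLaw_of_quarterModulus (h : durhuusFrohlich_areaLaw_of_slabClustering 4 2) {βW : ℝ}
    (hβ : 0 ≤ βW) (hlt : βW < 2 / 7) (hq : OneLinkKRModulusSU2 βW (1 / 4)) :
    HasAreaLaw 4 (fundamentalRep (Fin 2)) (βW / 2) :=
  su2_hasAreaLaw_of_oneLinkKRModulusSU2 h hβ (by norm_num) hq (by nlinarith)

end AreaLaw

/-- **`SU(2)` AREA LAW FOR ALL `0 ≤ βW < 2/7`, `d = 4`** — hypothesis-free on the one-link side: the quarter modulus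
`OneLinkKRModulusSU2 βW (1/4)` IS an in-tree theorem for `βW < 2/7` (`quarterModulusUpTo_twoSevenths`, pub-balaban leaves (33·x)),
so the only remaining hypothesis is the printed Durhuus–Fröhlich/CNS criterion (named fact).  Printed comparison: CNS25 Thm. 1.6 gives the
`SU(2)` area law for 't Hooft `β < 1/24`, i.e. `βW < 1/6`; here `βW < 2/7` (`×12/7`).  Strong-coupling lattice statement only.
[cite: CaoNissimSheffield2025dynamical, Theorems 1.6 and 2.3] -/
theorem su2_hasAreaLaw_lt_twoSevenths (h : durhuusFrohlich_areaLaw_of_slabClustering 4 2) {βW : ℝ}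
    (hβ : 0 ≤ βW) (hlt : βW < 2 / 7) : HasAreaLaw 4 (fundamentalRep (Fin 2)) (βW / 2) :=
  su2_hasAreaLaw_of_quarterModulus h hβ hlt
    (Summit.QuantumFields.BalabanUV.InfraRed.StrongCouplingQuarterModulusTwoSevenths.quarterModulusUpTo_twoSevenths βW hβ hlt)

end Summit.Ventures.YMGap.Slab
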